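import Summits.BirchSwinnertonDyer.BirchSwinnertonDyer.Theorems.EisensteinPrimesKellerYinLemma511OfBrAnomOfSurC
import Summits.BirchSwinnertonDyer.BirchSwinnertonDyer.Theorems.EisensteinPrimesBSDpOnCellCBrOmegaMultHeavyOfPoitouTateAt
import Summits.BirchSwinnertonDyer.BirchSwinnertonDyer.Theorems.EisensteinPrimesCharMainConjOnTreeOfPoitouTateAt
import Summits.BirchSwinnertonDyer.BirchSwinnertonDyer.Theorems.EisensteinPrimesKellerYinLemma511NonsplitOfPrimitive
import Summits.BirchSwinnertonDyer.BirchSwinnertonDyer.Theorems.EisensteinPrimesSplitMultCharImprimitiveShiftOfSurC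
import HarnessLib

/-!
# Keller–Yin Lemma 5.1.1 BY NAME WITHOUT CGLS Prop. 1.2.5: the NON-SPLIT half (`𝔛^{Sf}_f` Λ-torsion, μ = 0) from BCGKPST Thm. 3.3.1, Milne I 4.10 (a),
# de Shalit II.6.4, Hida Thm. I and CGLS Thm. 2.1.2 (the character main-conjecture engines at the Teichmüller pair) — cell `bsd-eis`, width seat
# `bsd-line-x2-p2` gen 27; crux 4 `BSDpOnCellC` stmt-BirchSwinnertonDyer-19034, line telescope v21 UNCHANGED; P4-f1/f2 of the C2 programme (evidence #59)

WHY. In crux 4's v21 cone Keller–Yin Lemma 5.1.1 (`lemma511_imprimitive_isTorsion_muInvariant_eq_zero_mult_OPEN`, fed to the assembly by name) is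
DERIVED by `KellerYinLemma511OfBrAnom.lemma511_OPEN_of_prop125_of_brAnom_of_pub_ofSurC`: the SPLIT half from [BR𝟙-anom] ∧ [BRω-split] (the four
refereed names), the NON-SPLIT half from CGLS Prop. 1.2.5 (`TeichmullerPairUnramifiedAtMult.lemma511Nonsplit_of_prop125`). Here the non-split half is
re-derived from the same four names + CGLS Thm. 2.1.2 (Katz) instead: §1 `lemma511Nonsplit_of_pub_ofPoitouTateAt` runs the split half's own template
(x2-p2 g12/g16: the partner prime `𝔭` of degree one, an embedding `ι' : ℚ̄_p ≃ ℂ` reading it, the Teichmüller pair `(θs, θq)` of a rational line,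
orientation by `teichmullerPair_isUnramifiedAt_or`) with the NON-split engines — `CharMainConjOnTreeOfPub.charMainConjOnTree_ofPoitouTateAt` at the
`p`-unramified member `φ` (no anomalous clause needed) and `BrOmegaMultHeavyOfPub.omegaSideTeichmullerPair_ofPoitouTateAt` at `ψ` — to get the
PRIMITIVE unramified (f.g., torsion, μ = 0) triples of both members, then this seat's prop14-free dévissage
`KellerYinLemma511NonsplitOfPrimitive.xAc_moduleFinite_isTorsion_muInvariant_of_primitive_of_not_split` (p792380). §2 `lemma511_OPEN_of_pub_ofSurC` is
the prop125-DROP twin of `lemma511_OPEN_of_prop125_of_brAnom_of_pub_ofSurC` (same binders minus `hprop125`, plus `h331 hX hF hO1`).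

HONEST FRAMING: theorems only (no definition, no named fact, no `sorry`, no instance); CONDITIONAL on the refereed names carried as hypotheses
(`h331 hX hF hO1 hF1 h263 h41 h42 h5A` and the inline walls `hbrA hωS` for the split half); closes no stub, discharges no Literature fact, moves no
count (27 names by name of record); nothing «redundant» until the closure lands (host (C2)); BSD / Keller–Yin's theorem is proved for no curve.
-/

set_option autoImplicit false
set_option linter.dupNamespace false -- the summit namespace `…BirchSwinnertonDyer.BirchSwinnertonDyer.Theorems` (Sub = Summit, D-0017) trips it

noncomputable section

open scoped Classical MatrixGroups ModularForm

open CongruenceSubgroup WeierstrassCurve NumberField IsDedekindDomain Field PowerSeries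
  Literature.NumberTheory.EllipticCurves Literature.NumberTheory.EllipticCurves.GreenbergSelmer
  Literature.NumberTheory.EllipticCurves.ModularForms Literature.NumberTheory.QuadraticFields
  Literature.NumberTheory.EllipticCurves.Rank1Residual
  Literature.NumberTheory.EllipticCurves.Rank1Residual.Typed
  Literature.NumberTheory.EllipticCurves.KrizLi2019
  Literature.NumberTheory.EllipticCurves.GreenbergVatsal2000
  Literature.NumberTheory.EllipticCurves.Wuthrich2014
  Literature.NumberTheory.EllipticCurves.SteinWuthrich2013
  Literature.NumberTheory.EllipticCurves.Castella2018Exceptional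
  Literature.NumberTheory.EllipticCurves.Castella2018
  Literature.NumberTheory.GaloisRepresentations Literature.NumberTheory.GaloisCohomology
  Literature.NumberTheory.Automorphic
  Literature.NumberTheory.EllipticCurves.CastellaGrossiLeeSkinner2022
  Literature.NumberTheory.IwasawaTheory Literature.NumberTheory.IwasawaTheory.Greenberg2016
  Literature.NumberTheory.IwasawaTheory.Greenberg2006
  Summit.BirchSwinnertonDyer.Rank1Residual.X11b.AcSelmer
  Summit.BirchSwinnertonDyer.Rank1Residual.X11b.Halves
  Summit.BirchSwinnertonDyer.Rank1Residual.X11b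
  Summit.BirchSwinnertonDyer.Rank1Residual Summit.BirchSwinnertonDyer.Rank1Residual.X1
  Summit.BirchSwinnertonDyer.Rank1Residual.X1.KellerYinMuLambdaSplit
  Summit.BirchSwinnertonDyer.Rank1Residual.X2
  Summit.BirchSwinnertonDyer.BirchSwinnertonDyer.Theorems
  Summit.BirchSwinnertonDyer.BirchSwinnertonDyer.Theorems.EisensteinPrimesMuLambda
open Literature.NumberTheory.EllipticCurves.KellerYin2024

namespace Summit.BirchSwinnertonDyer.BirchSwinnertonDyer.Theorems.KellerYinLemma511OfPub

open Summit.BirchSwinnertonDyer.BirchSwinnertonDyer.Theorems.KellerYinLemma511OfBrAnom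
  Literature.NumberTheory.EllipticCurves.BCGKPST2020 Literature.NumberTheory.EllipticCurves.DeShalit1987
  Literature.NumberTheory.EllipticCurves.Hida2010MuInvariant

/-! ## §1 The NON-SPLIT half of Keller–Yin Lemma 5.1.1 from the four names + CGLS Thm. 2.1.2 -/

/-- **The NON-SPLIT half of Keller–Yin Lemma 5.1.1 (member `f`) from the character main conjectures, WITHOUT CGLS Prop. 1.2.5 / Prop. 14 by name.**
At the datum of the named fact (`2 < p`, `Mult`, NON-split, `Red`; `K` imaginary quadratic Heegner for `N_W`, `D_K` odd `≠ −3`, `(p)` split; `v̄ ∋ p`;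
`κ` anticyclotomic with generator `γ`; `Sf` = places over `N_W` off `p`): `𝔛^{Sf}_f = XAc E_K p κ v̄ ↑Sf γ` is `Λ`-torsion with `μ = 0` — GRANTED
BCGKPST 2020 Thm. 3.3.1 (`h331`), Milne ADT I 4.10 (a) at TC fields (`hX`), de Shalit II.6.4 (`hF`), Hida 2010 Thm. I (`hO1`), CGLS Thm. 2.1.2
(`hF1`) BY NAME. Proof: the partner prime `𝔭 ∣ p` (degree one), `ι' : ℚ̄_p ≃ ℂ` reading it, the Teichmüller pair `(θs, θq)` of a rational line
(`exists_teichmullerPair`; a residual pair over `K`); for the member `φ` unramified at `p` (`teichmullerPair_isUnramifiedAt_or`) the Hecke character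
`θ_K` of `φ|_K` and its Katz frame (`hF1`); [BR] at `φ` (`charMainConjOnTree_ofPoitouTateAt`) and the ω-side at `ψ`
(`omegaSideTeichmullerPair_ofPoitouTateAt`) give the PRIMITIVE unramified (f.g., torsion, `μ = 0`) triples of both members; then this seat's
prop14-free dévissage `xAc_moduleFinite_isTorsion_muInvariant_of_primitive_of_not_split`. The prop125-free twin of
`TeichmullerPairUnramifiedAtMult.lemma511Nonsplit_of_prop125`. [cite: KellerYin2024, Lemma 5.1.1 (arXiv:2402.12781v2 §5.1 TeX L1744–1749), Thm. 1.2.2]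
[cite: CastellaGrossiLeeSkinner2022, Thm. 1.2.2, §1.4 Props. 17–18, Thm. 2.1.2 (arXiv:2008.02571)] [cite: BleherEtAl2020, §3.3 Thm. 3.3.1] [cite: deShalit1987, II.6.4]
[cite: Hida2010MuInvariant, Thm. I] [cite: MilneADT2006, I Thm. 4.10 (a)] [cite: SilvermanATAEC1994, V.5.3] -/
theorem lemma511Nonsplit_of_pub_ofPoitouTateAt
    (h331 : thm331_rubin_exists_katzMeasure₂_pseudoIso_span_eq)
    (hX : ∀ (L : Type) [Field L] [NumberField L] [IsTotallyComplex L] (S : Set (HeightOneSpectrum (𝓞 L))),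
      S.Finite → Literature.NumberTheory.GaloisCohomology.poitouTate_shaRestricted_tateDual_natural_at L S)
    (hF : thmII64_katzMeasure₂_functionalEquation) (hO1 : thmI_mu_katzBranch_reflect_eq_zero)
    (hF1 : thm212_exists_isKatzLFunction)
    {p : ℕ} [Fact p.Prime] (W : WeierstrassCurve ℚ) [W.IsElliptic] [W.IsGloballyMinimal]
    (K : Type) [Field K] [NumberField K] (vbar : HeightOneSpectrum (𝓞 K))
    (κ : ZpExtension K p) (γ : absoluteGaloisGroup K) [Fact (κ.IsTopGenerator γ)]
    (Sf : Finset (HeightOneSpectrum (𝓞 K)))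
    (hp2 : 2 < p) (hmult : Mult W p) (hns : ¬ W.HasSplitMultiplicativeReductionAtPrime p) (hred : Red W p)
    (hK : IsImaginaryQuadratic K) (hHN : SatisfiesHeegnerHypothesis (W.conductorNorm ℤ) K)
    (hodd : Odd (NumberField.discr K)) (hd3 : NumberField.discr K ≠ -3)
    (hsplit : ((Ideal.span {(p : ℤ)}).primesOver (𝓞 K)).ncard = 2)
    (hvbar : ((p : ℕ) : 𝓞 K) ∈ vbar.asIdeal) (hκ : κ.IsAnticyclotomic)
    (hSf : ∀ w : HeightOneSpectrum (𝓞 K), w ∈ Sf ↔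
      (((W.conductorNorm ℤ : ℤ) : 𝓞 K) ∈ w.asIdeal ∧ ((p : ℕ) : 𝓞 K) ∉ w.asIdeal)) :
    Module.IsTorsion (IwasawaAlgebra p) (XAc (W.baseChange K) p κ vbar (↑Sf : Set (HeightOneSpectrum (𝓞 K))) γ) ∧
      muInvariant p (XAc (W.baseChange K) p κ vbar (↑Sf : Set (HeightOneSpectrum (𝓞 K))) γ) = 0 := by
  have hp2' : p ≠ 2 := by omega
  have hγ : κ.IsTopGenerator γ := Fact.out
  haveI : (W.baseChange K).IsElliptic := inferInstanceAs (W.map (algebraMap ℚ K)).IsElliptic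
  -- the second prime `𝔭 ≠ v̄` over `p`, of degree one, and an embedding `ι' : ℚ̄_p ≃ ℂ` cutting it out
  obtain ⟨𝔭, h𝔭, hne⟩ := CharGrSelmerCorankGeOfFacts.exists_other_prime_of_ncard_primesOver_eq_two hsplit vbar hvbar
  obtain ⟨he1, hf1⟩ := X11b.degreeOne_of_splitsIn (K := K) (p := p) hK.1 hsplit h𝔭
  obtain ⟨ι₀⟩ := PadicAlgCl.nonempty_ringEquiv_complex p
  obtain ⟨ι', -, hι'⟩ := X11b.exists_datum_forall_mem_iff p ι₀ hK h𝔭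
  have hHp : SatisfiesHeegnerHypothesis p K := fun q hq hqp ↦ by
    rw [(Nat.prime_dvd_prime_iff_eq hq (Fact.out : p.Prime)).mp hqp]; exact hsplit
  set ι : K →+* ℚ_[p] := X11b.embAt K p 𝔭 h𝔭 he1 hf1 with hιdef
  have hvι : ∀ x : 𝓞 K, x ∈ 𝔭.asIdeal ↔ ‖ι (x : K)‖ < 1 := X11b.mem_asIdeal_iff_norm_embAt_lt_one 𝔭 h𝔭 he1 hf1
  -- the Teichmüller pair over `ℚ` of a rational line and its restriction to `K`
  obtain ⟨Φ, hΦ, θs, θq, hs, hq⟩ := exists_teichmullerPair W p hred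
  have hpair : IsResidualPairOver (W.baseChange K) p (θs.restrictField K) (θq.restrictField K) :=
    isResidualPairOver_restrictField W p K hΦ hs hq
  have hcardΦ : Nat.card (Φ.map (geomTorsion W (p : ℤ)).subtype) = p := by
    rw [Nat.card_congr (Φ.equivMapOfInjective (geomTorsion W (p : ℤ)).subtype
      (geomTorsion W (p : ℤ)).subtype_injective).toEquiv.symm, hΦ.1]
  have hle : Φ.map (geomTorsion W (p : ℤ)).subtype ≤ geomTorsion W (p : ℤ) := by
    rintro _ ⟨R, _, rfl⟩
    exact R.2
  -- both members are unramified off `N_W p`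
  have hunrs : ∀ u : HeightOneSpectrum (𝓞 ℚ), ((W.conductorNorm ℤ : ℤ) : 𝓞 ℚ) ∉ u.asIdeal →
      ((p : ℕ) : 𝓞 ℚ) ∉ u.asIdeal → θs.IsUnramifiedAt u := fun u hu hpu ↦
    isUnramifiedAt_of_isTeichmullerLiftOn W (∅ : Set (PadicAlgCl p)) hcardΦ hle hs
      (hasGoodReductionAt_of_conductorNorm_notMem W u hu) hpu
  have hunrq : ∀ u : HeightOneSpectrum (𝓞 ℚ), ((W.conductorNorm ℤ : ℤ) : 𝓞 ℚ) ∉ u.asIdeal →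
      ((p : ℕ) : 𝓞 ℚ) ∉ u.asIdeal → θq.IsUnramifiedAt u := fun u hu hpu ↦
    isUnramifiedAt_of_isTeichmullerLiftOnQuot W (∅ : Set (PadicAlgCl p)) hcardΦ hq
      (hasGoodReductionAt_of_conductorNorm_notMem W u hu) hpu
  -- ORIENTATION-FREE CORE: given the member `φ` unramified at `p`, run [F1b], [BR] at `φ` and the ω-side at `ψ` (NO anomalous clause)
  have core : ∀ (φ ψ : FramedGaloisRep ℚ (padicCoeffIntegers (∅ : Set (PadicAlgCl p))) 1),
      (φ = θs ∧ ψ = θq ∨ φ = θq ∧ ψ = θs) →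
      (∀ u : HeightOneSpectrum (𝓞 ℚ), ((p : ℕ) : 𝓞 ℚ) ∈ u.asIdeal → φ.IsUnramifiedAt u) →
      (∀ σ : absoluteGaloisGroup ℚ, φ σ ^ (p - 1) = 1) →
      (∀ u : HeightOneSpectrum (𝓞 ℚ), ((W.conductorNorm ℤ : ℤ) : 𝓞 ℚ) ∉ u.asIdeal →
        ((p : ℕ) : 𝓞 ℚ) ∉ u.asIdeal → φ.IsUnramifiedAt u) →
      (∀ D : DatumDualData κ γ (charModule (∅ : Set (PadicAlgCl p)) (φ.restrictField K))
          (Castella2018.AcSelmer.bdpData (charModule (∅ : Set (PadicAlgCl p)) (φ.restrictField K)) p vbar)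
          (∅ : Set (HeightOneSpectrum (𝓞 K))),
        Module.Finite (IwasawaAlgebra p) D.X ∧ Module.IsTorsion (IwasawaAlgebra p) D.X ∧ muInvariant p D.X = 0) ∧
      (∀ D : DatumDualData κ γ (charModule (∅ : Set (PadicAlgCl p)) (ψ.restrictField K))
          (Castella2018.AcSelmer.bdpData (charModule (∅ : Set (PadicAlgCl p)) (ψ.restrictField K)) p vbar)
          (∅ : Set (HeightOneSpectrum (𝓞 K))),
        Module.Finite (IwasawaAlgebra p) D.X ∧ Module.IsTorsion (IwasawaAlgebra p) D.X ∧ muInvariant p D.X = 0) := by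
    intro φ ψ hor hφp hTφ hunrφ'
    have hTφK : ∀ σ : absoluteGaloisGroup K, φ.restrictField K σ ^ (p - 1) = 1 := fun σ ↦ hTφ _
    have hunr : ∀ u : HeightOneSpectrum (𝓞 ℚ), ((W.conductorNorm ℤ : ℤ) : 𝓞 ℚ) ∉ u.asIdeal → φ.IsUnramifiedAt u := by
      intro u hu
      by_cases hpu : ((p : ℕ) : 𝓞 ℚ) ∈ u.asIdeal
      · exact hφp u hpu
      · exact hunrφ' u hu hpu
    -- the Hecke character `θ_K` of `φ|_{G_K}` and its Katz frame ([F1b])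
    obtain ⟨θK, -, hθK'⟩ := exists_heckeCharacter_of_pow_eq_one (∅ : Set (PadicAlgCl p)) ι' (φ.restrictField K) hTφK
    have hθK : IsHeckeCharOf ι' (φ.restrictField K) θK := hθK'
    obtain ⟨ΩK₁, Ωp₁, L₁, hΩK₁, hL₁⟩ :=
      hF1 p hp2 K hK hHp hodd hd3 ι 𝔭 vbar hvι hvbar hne κ hκ γ ι' hι' φ hTφ (W.conductorNorm ℤ) hHN hunr hφp θK hθK
    have hCbar : ∀ u ∈ (∅ : Finset (HeightOneSpectrum (𝓞 K))), ¬ θK.IsUnramifiedAt u := by simp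
    obtain ⟨D0φ⟩ := nonempty_unrDualData_char (∅ : Set (PadicAlgCl p)) (φ.restrictField K) κ vbar
      (∅ : Set (HeightOneSpectrum (𝓞 K))) hγ
    -- [BR] at `φ` (no anomalous clause): the index `nφ`
    obtain ⟨-, -, -, nφ, hnφ, -⟩ := CharMainConjOnTreeOfPub.charMainConjOnTree_ofPoitouTateAt h331 hX hF hO1 p hp2 K hK hHp hodd hd3 ι 𝔭
      vbar hvι hvbar hne κ hκ γ ι' hι' φ hTφ (W.conductorNorm ℤ) hHN hunr hφp θK hθK D0φ ∅ hCbar ΩK₁ Ωp₁ L₁ hΩK₁ hL₁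
    refine ⟨fun D ↦ ?_, fun D ↦ ?_⟩
    · obtain ⟨h1, h2, h3, -⟩ := CharMainConjOnTreeOfPub.charMainConjOnTree_ofPoitouTateAt h331 hX hF hO1 p hp2 K hK hHp hodd hd3 ι 𝔭
        vbar hvι hvbar hne κ hκ γ ι' hι' φ hTφ (W.conductorNorm ℤ) hHN hunr hφp θK hθK D ∅ hCbar ΩK₁ Ωp₁ L₁ hΩK₁ hL₁
      exact ⟨h1, h2, h3⟩
    · -- the ω-side at `ψ` (reduction-type-free wall, x2-p2 g18)
      obtain ⟨h1, h2, h3, -⟩ := BrOmegaMultHeavyOfPub.omegaSideTeichmullerPair_ofPoitouTateAt h331 hX hF hO1 W p hp2 K hK hHN hodd hd3 κ hκ γ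
        𝔭 h𝔭 he1 hf1 vbar hvbar hne hsplit ι' hι' Φ hΦ θs θq hs hq φ ψ hor hφp θK hθK ∅ hCbar ΩK₁ Ωp₁ L₁ hΩK₁ hL₁ nφ hnφ D
      exact ⟨h1, h2, h3⟩
  -- ORIENTATION: one member of the pair is unramified at the multiplicative `p` (no anomalous clause at a NON-split prime)
  have hRH : (∀ D : DatumDualData κ γ (charModule (∅ : Set (PadicAlgCl p)) (θs.restrictField K))
          (Castella2018.AcSelmer.bdpData (charModule (∅ : Set (PadicAlgCl p)) (θs.restrictField K)) p vbar)
          (∅ : Set (HeightOneSpectrum (𝓞 K))),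
        Module.Finite (IwasawaAlgebra p) D.X ∧ Module.IsTorsion (IwasawaAlgebra p) D.X ∧ muInvariant p D.X = 0) ∧
      (∀ D : DatumDualData κ γ (charModule (∅ : Set (PadicAlgCl p)) (θq.restrictField K))
          (Castella2018.AcSelmer.bdpData (charModule (∅ : Set (PadicAlgCl p)) (θq.restrictField K)) p vbar)
          (∅ : Set (HeightOneSpectrum (𝓞 K))),
        Module.Finite (IwasawaAlgebra p) D.X ∧ Module.IsTorsion (IwasawaAlgebra p) D.X ∧ muInvariant p D.X = 0) := by
    rcases TeichmullerPairUnramifiedAtMult.teichmullerPair_isUnramifiedAt_or W p hp2' hmult hΦ hs hq with hφp | hφp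
    · exact core θs θq (Or.inl ⟨rfl, rfl⟩) hφp hs.1 hunrs
    · obtain ⟨hq', hs'⟩ := core θq θs (Or.inr ⟨rfl, rfl⟩) hφp hq.1 hunrq
      exact ⟨hs', hq'⟩
  obtain ⟨hRHsub, hRHquot⟩ := hRH
  -- the prop14-free dévissage (this seat, P4-b)
  obtain ⟨-, htor, hμ⟩ := KellerYinLemma511NonsplitOfPrimitive.xAc_moduleFinite_isTorsion_muInvariant_of_primitive_of_not_split W K vbar κ γ Sf
    hp2 hmult hns hK hHN hsplit hvbar hκ hSf (θs.restrictField K) (θq.restrictField K) hpair hRHsub hRHquot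
  exact ⟨htor, hμ⟩

/-! ## §2 The named fact, by cases on the sign, WITHOUT CGLS Prop. 1.2.5 -/

/-- **[prop125-DROP twin of `lemma511_OPEN_of_prop125_of_brAnom_of_pub_ofSurC`: `(hprop125 : prop125_…)` ↦ `(h331) (hX) (hF) (hO1)` (three of them
already implicit in the inline walls `hbrA`/`hωS` the original takes); the non-split half now comes from §1.]** **Keller–Yin Lemma 5.1.1 BY NAME**
(`KellerYin2024.lemma511_imprimitive_isTorsion_muInvariant_eq_zero_mult_OPEN`): the SPLIT half is x2-p2 g16's `lemma511_split_of_brAnom_of_pub_ofSurC`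
(unchanged: [BR𝟙-anom] `hbrA`, [BRω-split] `hωS`, Greenberg 2016 Prop. 2.6.3 (c) TC, Greenberg 2006 Props. 4.1/4.2/§5 A, CGLS Thm. 2.1.2), the
NON-SPLIT half is §1. CONDITIONAL on the named facts and the inline walls; closes no registered stub by itself; nothing «redundant» until the closure
lands. [cite: KellerYin2024, Lemma 5.1.1 (arXiv:2402.12781v2 §5.1 TeX L1744–1749)]
[cite: CastellaGrossiLeeSkinner2022, Thm. 1.2.2, Thm. 2.1.2 (arXiv:2008.02571)] [cite: Greenberg2016Selmer, Prop. 2.6.3 (c)] [cite: BleherEtAl2020, §3.3 Thm. 3.3.1] -/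
theorem lemma511_OPEN_of_pub_ofSurC
    (h331 : thm331_rubin_exists_katzMeasure₂_pseudoIso_span_eq)
    (hX : ∀ (L : Type) [Field L] [NumberField L] [IsTotallyComplex L] (S : Set (HeightOneSpectrum (𝓞 L))),
      S.Finite → Literature.NumberTheory.GaloisCohomology.poitouTate_shaRestricted_tateDual_natural_at L S)
    (hF : thmII64_katzMeasure₂_functionalEquation) (hO1 : thmI_mu_katzBranch_reflect_eq_zero)
    (h263 : prop263_sur_of_crk_caseC_tc) (h41 : prop41_globalEulerPoincareCorank)
    (h42 : prop42_localEulerPoincareCorank) (h5A : sec5A_localH2_subsingleton_of_LOC1)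
    (hF1 : thm212_exists_isKatzLFunction)
    (hbrA : ∀ (p : ℕ) [Fact p.Prime],
      2 < p → ∀ (K : Type) [Field K] [NumberField K], IsImaginaryQuadratic K →
        SatisfiesHeegnerHypothesis p K → Odd (NumberField.discr K) → NumberField.discr K ≠ -3 →
      ∀ (ι : K →+* ℚ_[p]) (v vbar : HeightOneSpectrum (𝓞 K)),
        (∀ x : 𝓞 K, x ∈ v.asIdeal ↔ ‖ι (x : K)‖ < 1) →
        ((p : ℕ) : 𝓞 K) ∈ vbar.asIdeal → vbar ≠ v →
      ∀ (κ : ZpExtension K p), κ.IsAnticyclotomic →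
      ∀ (γ : absoluteGaloisGroup K) [Fact (κ.IsTopGenerator γ)],
      ∀ (ι' : PadicAlgCl p ≃+* ℂ),
        (∀ (w : InfinitePlace K) (k : 𝓞 K), k ∈ v.asIdeal ↔ ‖ι'.symm (w.embedding (k : K))‖ < 1) →
      ∀ (θ : FramedGaloisRep ℚ (padicCoeffIntegers (∅ : Set (PadicAlgCl p))) 1),
        (∀ σ : absoluteGaloisGroup ℚ, θ σ ^ (p - 1) = 1) →
      ∀ (C : ℕ), SatisfiesHeegnerHypothesis C K →
        (∀ u : HeightOneSpectrum (𝓞 ℚ), ((C : ℤ) : 𝓞 ℚ) ∉ u.asIdeal → θ.IsUnramifiedAt u) →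
        (∀ u : HeightOneSpectrum (𝓞 ℚ), ((p : ℕ) : 𝓞 ℚ) ∈ u.asIdeal → θ.IsUnramifiedAt u) →
        (∀ g ∈ decomp vbar, ∀ m : charModule (∅ : Set (PadicAlgCl p)) (θ.restrictField K), p • m = 0 → g • m = m) →
      ∀ (θK : HeckeCharacter K), IsHeckeCharOf ι' (θ.restrictField K) θK →
      ∀ (D : DatumDualData κ γ (charModule (∅ : Set (PadicAlgCl p)) (θ.restrictField K))
          (Castella2018.AcSelmer.bdpData (charModule (∅ : Set (PadicAlgCl p)) (θ.restrictField K)) p vbar)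
          (∅ : Set (HeightOneSpectrum (𝓞 K)))),
      ∀ (Cbar : Finset (HeightOneSpectrum (𝓞 K))), (∀ u ∈ Cbar, ¬ θK.IsUnramifiedAt u) →
      ∀ (ΩK : ℂ) (Ωp : (unrIntegers p)ˣ) (L : UnrSeries p), ΩK ≠ 0 →
        IsKatzLFunction ι' v vbar Cbar κ γ θK ΩK ((Ωp : unrIntegers p) : ℂ_[p]) L →
      Module.Finite (IwasawaAlgebra p) D.X ∧ Module.IsTorsion (IwasawaAlgebra p) D.X ∧
        muInvariant p D.X = 0 ∧
        ∃ m : ℕ, FirstUnitCoeffAt L m ∧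
          lambdaInvariant p D.X =
            m + (if ∀ σ : absoluteGaloisGroup K, θ.restrictField K σ = 1 then 1 else 0))
    (hωS :
      (∀ (W : WeierstrassCurve ℚ) [W.IsElliptic] [W.IsGloballyMinimal] (p : ℕ) [Fact p.Prime],
        2 < p → Mult W p → W.HasSplitMultiplicativeReductionAtPrime p →
        ∀ (K : Type) [Field K] [NumberField K],
          IsImaginaryQuadratic K → SatisfiesHeegnerHypothesis (W.conductorNorm ℤ) K →
          Odd (NumberField.discr K) → NumberField.discr K ≠ -3 →
          ∀ (κ : ZpExtension K p), κ.IsAnticyclotomic →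
            ∀ (γ : Field.absoluteGaloisGroup K) [Fact (κ.IsTopGenerator γ)]
              (𝔭 : HeightOneSpectrum (𝓞 K)), ((p : ℕ) : 𝓞 K) ∈ 𝔭.asIdeal →
              𝔭.asIdeal.ramificationIdx (𝓞 ℚ) = 1 → 𝔭.asIdeal.inertiaDeg (𝓞 ℚ) = 1 →
              ∀ (𝔭bar : HeightOneSpectrum (𝓞 K)), ((p : ℕ) : 𝓞 K) ∈ 𝔭bar.asIdeal → 𝔭bar ≠ 𝔭 →
                ((Ideal.span {(p : ℤ)}).primesOver (𝓞 K)).ncard = 2 →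
              ∀ (ι' : PadicAlgCl p ≃+* ℂ),
                (∀ (w : InfinitePlace K) (k : 𝓞 K), k ∈ 𝔭.asIdeal ↔ ‖ι'.symm (w.embedding (k : K))‖ < 1) →
              ∀ (Φ : AddSubgroup (geomTorsion W (p : ℤ))), IsRationalLine W p Φ →
              ∀ (θsub θquot : FramedGaloisRep ℚ (padicCoeffIntegers (∅ : Set (PadicAlgCl p))) 1),
                IsTeichmullerLiftOn (∅ : Set (PadicAlgCl p)) (Φ.map (geomTorsion W (p : ℤ)).subtype) θsub →
                IsTeichmullerLiftOnQuot (∅ : Set (PadicAlgCl p)) (Φ.map (geomTorsion W (p : ℤ)).subtype)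
                  (geomTorsion W (p : ℤ)) θquot →
              ∀ (φ ψ : FramedGaloisRep ℚ (padicCoeffIntegers (∅ : Set (PadicAlgCl p))) 1),
                (φ = θsub ∧ ψ = θquot ∨ φ = θquot ∧ ψ = θsub) →
                (∀ u : HeightOneSpectrum (𝓞 ℚ), ((p : ℕ) : 𝓞 ℚ) ∈ u.asIdeal → φ.IsUnramifiedAt u) →
              ∀ (θK : HeckeCharacter K), IsHeckeCharOf ι' (φ.restrictField K) θK →
              ∀ (Cbar : Finset (HeightOneSpectrum (𝓞 K))), (∀ u ∈ Cbar, ¬ θK.IsUnramifiedAt u) →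
              ∀ (ΩK' : ℂ) (Ωp' : (unrIntegers p)ˣ) (Lφ : UnrSeries p), ΩK' ≠ 0 →
                IsKatzLFunction ι' 𝔭 𝔭bar Cbar κ γ θK ΩK' ((Ωp' : unrIntegers p) : ℂ_[p]) Lφ →
              ∀ nφ : ℕ, FirstUnitCoeffAt Lφ nφ →
              ∀ (Dψ : DatumDualData κ γ (charModule (∅ : Set (PadicAlgCl p)) (ψ.restrictField K))
                  (Castella2018.AcSelmer.bdpData (charModule (∅ : Set (PadicAlgCl p)) (ψ.restrictField K)) p 𝔭bar)
                  (∅ : Set (HeightOneSpectrum (𝓞 K)))),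
                Module.Finite (IwasawaAlgebra p) Dψ.X ∧ Module.IsTorsion (IwasawaAlgebra p) Dψ.X ∧
                  muInvariant p Dψ.X = 0 ∧ lambdaInvariant p Dψ.X = nφ)) :
    lemma511_imprimitive_isTorsion_muInvariant_eq_zero_mult_OPEN := by
  intro p _ W _ _ K _ _ vbar κ γ _ Sf hp2 hmult hred hK hHN hodd hd3 hsplit hvbar hκ hSf
  by_cases hs : W.HasSplitMultiplicativeReductionAtPrime p
  · exact lemma511_split_of_brAnom_of_pub_ofSurC h263 h41 h42 h5A hF1 hbrA hωS W K vbar κ γ Sf hp2 hmult hs hred hK hHN hodd hd3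
      hsplit hvbar hκ hSf
  · exact lemma511Nonsplit_of_pub_ofPoitouTateAt h331 hX hF hO1 hF1 W K vbar κ γ Sf hp2 hmult hs hred hK hHN hodd hd3 hsplit hvbar hκ hSf

end Summit.BirchSwinnertonDyer.BirchSwinnertonDyer.Theorems.KellerYinLemma511OfPub

end
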